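import Mathlib
import HarnessLib
import Literature.Analysis.FluidPDE.LocalTypeIMorreyProofs
import Literature.Analysis.FluidPDE.SereginSverakPressureLocalTypeI
import Literature.Analysis.FluidPDE.SpaceTimeRescaling
import Literature.Analysis.FluidPDE.SuitableWeakRescaling
import Summits.NavierStokesRegularity.NavierStokesRegularity.Theorems.HalfHolderEnergyHolderBridge
import Summits.NavierStokesRegularity.NavierStokesRegularity.Theorems.StretchingWellBindingEnstrophyQuarterLawDissipationQuantum
import Summits.NavierStokesRegularity.NavierStokesRegularity.Theorems.TypeIQuarterGateQuarterLawTypeIOneScaleTools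

/-!
# `TypeIQuarterGate.QuarterLawCountsScars` (item stmt-NavierStokesRegularity-23912) — the regularity
# criterion under the window law (one small-dissipation scale at the final time ⇒ bounded nearby)

Helper file (`--supports stmt-NavierStokesRegularity-23912`). For a classical solution on `[0,T)`
(viscosity `ν`), Leray–Hopf on `[0,T]`, with the window law `∫_a^b ∫ |curl u|² ≤ K √(b − a)`
(`0 ≤ a ≤ b ≤ T`): there are `η₁, ϱ₁ > 0` such that every point `x` whose physical final cylinder
`(T − ϱ²/ν, T) × B_ϱ(x)` dissipates at most `η₁ ϱ` for SOME `ϱ < ϱ₁` is a regular point at the final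
time: `‖u‖ ≤ A` on `[T − r², T) × B_r(x)` for some `r > 0`.

PROOF (tree theorems; the frame of `EnstrophyQuarterLaw.LocalTypeI.energy_ball_le_of_window` verbatim):
unit-viscosity rescaling `v(s,y) = ν⁻¹u(ν⁻¹s,y)` with Tao's pressure gauge; at the apex `(νT, x)` the
energy, the global `L^{3/2}` budget of the gauged pressure and the window law bound the top-scale
`A(r₁)`, `D(r₁)` and `E(r) ≤ KE` (`r ≤ r₁`), so Seregin 2006 L. 2.1(a) with centre-uniform constant
(`Seregin2020.scaledEnergies_bounded_of_cknE_le_unif`) gives `A + E + C + D ≤ KS` on `Q_R(νT,x)`,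
`R ≤ r₁/2`, uniformly in `x`; the dissipation quantum (`DissipationQuantum.small_of_cknE_le KS 1`) turns
`E(ϱ) ≤ η` into `|v| ≤ 1/(ϑϱ)` a.e. on `Q_{ϑϱ/2}(νT,x)`; un-zoom
(`ae_restrict_of_ae_restrict_preimage_stAffine`) and pass to every point by continuity
(`CountQuarterLaw.norm_le_of_ae_of_continuousOn`).

HONEST FRAMING: known ε-regularity (CKN 1982 Prop. 1 / Seregin 2006–2014) assembled from tree theorems
along ONE hypothetical solution obeying the window law; nothing about Navier–Stokes regularity or blow-up
is claimed. [cite: CaffarelliKohnNirenberg1982, Proposition 1] [cite: Seregin2006, Lemma 2.1 (a)]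
-/

noncomputable section

-- the summit-side namespace repeats a component by design (D-0017)
set_option linter.dupNamespace false

namespace Summit.NavierStokesRegularity.NavierStokesRegularity.Theorems.QuarterLawCountsScars

open Set MeasureTheory Function Metric Filter Topology
open scoped ENNReal NNReal
open Literature.Analysis.FluidPDE

variable {ν T : ℝ} {u : ℝ → EuclideanSpace ℝ (Fin 3) → EuclideanSpace ℝ (Fin 3)}
  {p : ℝ → EuclideanSpace ℝ (Fin 3) → ℝ}

/-- **Regularity criterion under the window law.** Classical solution on `[0,T)` (`ν > 0`), Leray–Hopf
on `[0,T]`, window law `∫_a^b ∫ |curl u|² ≤ K √(b − a)` (`K ≥ 0`): there are `η₁, ϱ₁ > 0` such that for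
every `x` and every `ϱ ∈ (0, ϱ₁)` with `∫_{T−ϱ²/ν}^{T} ∫_{B_ϱ(x)} |∇u|_F² ≤ η₁ ϱ`, the velocity is bounded
on `[T − r², T) × B_r(x)` for some `r > 0`. [cite: CaffarelliKohnNirenberg1982, Proposition 1]
[cite: Seregin2006, Lemma 2.1 (a) (arXiv:math/0607537 §2)] -/
theorem bounded_near_of_small_dissipation (hν : 0 < ν) (hT : 0 < T)
    (hsol : IsClassicalNSSolutionOn (Ico 0 T) ν 0 u p) (hLH : IsLerayHopfOn T ν 0 (u 0) u)
    {K : ℝ} (hK : 0 ≤ K)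
    (hwin : ∀ a b : ℝ, 0 ≤ a → a ≤ b → b ≤ T →
      ∫⁻ t in Ioo a b, ∫⁻ x, ‖curl (u t) x‖ₑ ^ 2 ≤ ENNReal.ofReal (K * Real.sqrt (b - a))) :
    ∃ η₁ ϱ₁ : ℝ, 0 < η₁ ∧ 0 < ϱ₁ ∧ ∀ (x : EuclideanSpace ℝ (Fin 3)), ∀ ϱ ∈ Ioo 0 ϱ₁,
      ∫⁻ w in Ioo (T - ν⁻¹ * ϱ ^ 2) T ×ˢ ball x ϱ,
          ENNReal.ofReal (frobeniusNormSq (fderiv ℝ (u w.1) w.2)) ≤ ENNReal.ofReal (η₁ * ϱ) →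
      ∃ r : ℝ, 0 < r ∧ ∃ A : ℝ, ∀ t ∈ Ico (T - r ^ 2) T, ∀ y ∈ ball x r, ‖u t y‖ ≤ A := by
  -- ### the unit-viscosity rescaling `v = α • stPull α 1 0 0 u`, `α = ν⁻¹`
  set α : ℝ := ν⁻¹ with hα
  have hαpos : 0 < α := inv_pos.2 hν
  have hαν : α * ν = 1 := by rw [hα, inv_mul_cancel₀ hν.ne']
  have hνα : ν * α = 1 := by rw [mul_comm, hαν]
  have hβeq : α = α * 1 := (mul_one α).symm
  set Sl : TopologicalSpace.Opens (ℝ × EuclideanSpace ℝ (Fin 3)) :=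
    ⟨Ioo 0 T ×ˢ univ, isOpen_Ioo.prod isOpen_univ⟩ with hSldef
  have hSlsub : (Sl : Set (ℝ × EuclideanSpace ℝ (Fin 3))) ⊆ Ioo 0 T ×ˢ univ := Subset.rfl
  set q : ℝ → EuclideanSpace ℝ (Fin 3) → ℝ := fun t x => p t x - (p t 0 - normalisedPressure (u t) 0)
    with hq
  have hsw : IsSuitableWeakSolutionOn (stPreimage α 1 0 0 Sl) 1 0 (α • stPull α 1 0 0 u)
      (α ^ 2 • stPull α 1 0 0 q) := by
    have h0 := (SereginSverak2002.isSuitableWeakSolutionOn_gauge_of_classical hν hT hsol hLH Sl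
      hSlsub).stRescale hαpos one_pos hβeq 0 0
    have hvisc : α * ν / 1 = 1 := by rw [div_one, hαν]
    have hforce : ((α ^ 2 * 1) • stPull α 1 0 0 (0 : ℝ → EuclideanSpace ℝ (Fin 3) →
        EuclideanSpace ℝ (Fin 3))) = 0 := by
      funext s y; simp [stPull]
    rw [hvisc, hforce] at h0
    exact h0
  have hGv : HasWeakSpatialGradientOn (stPreimage α 1 0 0 Sl) (α • stPull α 1 0 0 u)
      ((α * 1) • stPull α 1 0 0 fun t x => fderiv ℝ (u t) x) :=
    (hasWeakSpatialGradientOn_of_contDiffOn isOpen_Ioo hSlsub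
      ((SereginSverak2002.classical_Ioo hsol).smooth_velocity.of_le (by norm_cast))).stRescale
      α hαpos one_pos 0 0
  -- cylinders `Q_ρ(τ, x)` with `ρ² ≤ τ ≤ ν T` lie in the rescaled slab
  have hcyl : ∀ (τ ρ : ℝ) (x : EuclideanSpace ℝ (Fin 3)), ρ ^ 2 ≤ τ → τ ≤ ν * T →
      parabolicCylinder ρ ((τ, x) : ℝ × EuclideanSpace ℝ (Fin 3)) ⊆
        ((stPreimage α 1 0 0 Sl : TopologicalSpace.Opens (ℝ × EuclideanSpace ℝ (Fin 3))) :
          Set (ℝ × EuclideanSpace ℝ (Fin 3))) := by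
    intro τ ρ x hρτ hτT w hw
    rw [mem_parabolicCylinder] at hw
    change stAffine α 1 0 0 w ∈ Ioo 0 T ×ˢ (univ : Set (EuclideanSpace ℝ (Fin 3)))
    rw [mem_prod, stAffine_fst]
    have hw1 : 0 < w.1 := by nlinarith [hw.1.1, sq_nonneg ρ]
    have hw2 : α * w.1 < α * (ν * T) := mul_lt_mul_of_pos_left (lt_of_lt_of_le hw.1.2 hτT) hαpos
    have e : α * (ν * T) = T := by rw [← mul_assoc, hαν, one_mul]
    refine ⟨⟨by nlinarith [mul_pos hαpos hw1], by linarith⟩, mem_univ _⟩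
  -- ### the constants
  set r₁ : ℝ := min 1 (Real.sqrt (ν * T / 2)) with hr₁
  have hr₁pos : 0 < r₁ := lt_min one_pos (Real.sqrt_pos.2 (by positivity))
  have hr₁sq : r₁ ^ 2 ≤ ν * T / 2 := by
    have h1 : r₁ ≤ Real.sqrt (ν * T / 2) := min_le_right _ _
    have h2 := pow_le_pow_left₀ hr₁pos.le h1 2
    rwa [Real.sq_sqrt (by positivity)] at h2
  have hr₁0 : ENNReal.ofReal r₁ ≠ 0 := (ENNReal.ofReal_pos.2 hr₁pos).ne'
  set E₀ : ℝ := VectorCalculus.kineticEnergy (u 0) with hE₀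
  set A₀e : ℝ≥0∞ := (ENNReal.ofReal r₁)⁻¹ * (‖α‖ₑ ^ 2 * ENNReal.ofReal (2 * E₀)) with hA₀e
  have hA₀top : A₀e ≠ ⊤ := ENNReal.mul_ne_top (ENNReal.inv_ne_top.2 hr₁0)
    (ENNReal.mul_ne_top (by simp) ENNReal.ofReal_ne_top)
  set Pq : ℝ≥0∞ := ‖α ^ 2‖ₑ ^ (3 / 2 : ℝ) *
      ENNReal.ofReal (α * (1 : ℝ) ^ Module.finrank ℝ (EuclideanSpace ℝ (Fin 3)))⁻¹ *
      ∫⁻ z in Ioo 0 T ×ˢ (univ : Set (EuclideanSpace ℝ (Fin 3))), ‖q z.1 z.2‖ₑ ^ (3 / 2 : ℝ) with hPq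
  have hPqtop : Pq ≠ ⊤ :=
    ENNReal.mul_ne_top (ENNReal.mul_ne_top (ENNReal.rpow_ne_top_of_nonneg (by norm_num) enorm_ne_top)
      ENNReal.ofReal_ne_top) (SereginSverak2002.lintegral_slab_gauged_pressure_lt_top hν hT hsol hLH).ne
  set D₀e : ℝ≥0∞ := (ENNReal.ofReal r₁ ^ 2)⁻¹ * Pq with hD₀e
  have hD₀top : D₀e ≠ ⊤ := ENNReal.mul_ne_top (ENNReal.inv_ne_top.2 (pow_ne_zero _ hr₁0)) hPqtop
  set KE : ℝ := α * Real.sqrt α * K with hKE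
  have hKE0 : 0 ≤ KE := by positivity
  obtain ⟨KS, hKS⟩ :=
    Seregin2020.scaledEnergies_bounded_of_cknE_le_unif KE.toNNReal A₀e.toNNReal D₀e.toNNReal
  have hcont : ContinuousOn (uncurry u) (Ico 0 T ×ˢ (univ : Set (EuclideanSpace ℝ (Fin 3)))) :=
    SereginSverak2002.continuousOn_uncurry hsol
  have hανT : α * (ν * T) = T := by rw [← mul_assoc, hαν, one_mul]
  -- the physical cylinder behind `Q_r(νT, x)`
  have hpre : ∀ (r : ℝ) (x : EuclideanSpace ℝ (Fin 3)),
      stAffine α 1 0 0 ⁻¹' (Ioo (α * (ν * T - r ^ 2)) (α * (ν * T)) ×ˢ ball x r) =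
        parabolicCylinder r ((ν * T, x) : ℝ × EuclideanSpace ℝ (Fin 3)) := by
    intro r x
    ext w
    simp only [mem_preimage, mem_prod, stAffine_fst, stAffine_snd, mem_parabolicCylinder, mem_Ioo,
      mem_ball, zero_add, one_smul]
    constructor
    · rintro ⟨⟨h1, h2⟩, h3⟩
      exact ⟨⟨lt_of_mul_lt_mul_left h1 hαpos.le, lt_of_mul_lt_mul_left h2 hαpos.le⟩, h3⟩
    · rintro ⟨⟨h1, h2⟩, h3⟩
      exact ⟨⟨mul_lt_mul_of_pos_left h1 hαpos, mul_lt_mul_of_pos_left h2 hαpos⟩, h3⟩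
  -- the dissipation quantum at level `KS`, target `1`
  obtain ⟨η, ϑ, hη, hϑ, hϑ1, Hq⟩ := EnstrophyQuarterLaw.DissipationQuantum.small_of_cknE_le KS one_pos
  -- ### the claim
  refine ⟨ν * η, r₁ / 2, by positivity, by positivity, ?_⟩
  intro x ϱ hϱ hdiss
  obtain ⟨τ, hτ⟩ : ∃ τ : ℝ, τ = ν * T := ⟨_, rfl⟩
  have hτT : τ ≤ ν * T := hτ.le
  have hτ₁ : r₁ ^ 2 ≤ τ := by rw [hτ]; linarith [hr₁sq, mul_pos hν hT]
  set z : ℝ × EuclideanSpace ℝ (Fin 3) := (τ, x) with hz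
  have hzsub := hcyl τ r₁ x hτ₁ hτT
  -- (i) the top-scale energy bound `A(r₁) ≤ A₀`
  have hA : cknAEss r₁ z (α • stPull α 1 0 0 u) ≤ A₀e := by
    unfold cknAEss
    refine essSup_le_of_ae_le _ ?_
    filter_upwards [ae_restrict_mem measurableSet_Ioo] with s hs
    have hs' : z.1 - r₁ ^ 2 < s ∧ s < z.1 := hs
    have hs0 : 0 < s := by simp only [hz] at hs'; linarith [hs'.1]
    have hsT : α * s ∈ Icc 0 T := by
      refine ⟨by positivity, ?_⟩
      have h1 : α * s ≤ α * (ν * T) :=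
        mul_le_mul_of_nonneg_left ((show s < τ by simpa [hz] using hs'.2).le.trans hτT) hαpos.le
      rw [← mul_assoc, hαν, one_mul] at h1
      exact h1
    refine mul_le_mul' le_rfl ?_
    calc ∫⁻ y in ball z.2 r₁, ‖(α • stPull α 1 0 0 u) s y‖ₑ ^ 2
        = ∫⁻ y in ball z.2 r₁, ‖α‖ₑ ^ 2 * ‖u (α * s) y‖ₑ ^ 2 := by
          refine lintegral_congr fun y => ?_
          rw [smul_stPull_apply, enorm_smul, mul_pow, zero_add, zero_add, one_smul]
      _ = ‖α‖ₑ ^ 2 * ∫⁻ y in ball z.2 r₁, ‖u (α * s) y‖ₑ ^ 2 := by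
          rw [lintegral_const_mul' _ _ (by simp)]
      _ ≤ ‖α‖ₑ ^ 2 * ∫⁻ y, ‖u (α * s) y‖ₑ ^ 2 := mul_le_mul' le_rfl (setLIntegral_le_lintegral _ _)
      _ ≤ ‖α‖ₑ ^ 2 * ENNReal.ofReal (2 * E₀) :=
          mul_le_mul' le_rfl (hLH.lintegral_enorm_sq_le hν.le hsT)
  -- (ii) the top-scale pressure bound `D(r₁) ≤ D₀` (global `L^{3/2}` budget of the gauged pressure)
  have hD : cknD r₁ z (α ^ 2 • stPull α 1 0 0 q) ≤ D₀e := by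
    unfold cknD
    refine mul_le_mul' le_rfl ?_
    calc ∫⁻ w in parabolicCylinder r₁ z, ‖(α ^ 2 • stPull α 1 0 0 q) w.1 w.2‖ₑ ^ (3 / 2 : ℝ)
        ≤ ∫⁻ w in stAffine α 1 0 0 ⁻¹' (Ioo 0 T ×ˢ (univ : Set (EuclideanSpace ℝ (Fin 3)))),
            ‖(α ^ 2 • stPull α 1 0 0 q) w.1 w.2‖ₑ ^ (3 / 2 : ℝ) :=
          lintegral_mono_set hzsub
      _ = Pq := by
          rw [hPq, setLIntegral_enorm_rpow_stRescale hαpos one_pos 0 0 (α ^ 2) q _ (by norm_num)]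
  -- (iii) the scaled dissipation `E(r) ≤ KE` on every sub-scale, from the window law
  have hE : ∀ r ∈ Ioc (0 : ℝ) r₁,
      cknE r z ((α * 1) • stPull α 1 0 0 fun t x => fderiv ℝ (u t) x) ≤ ENNReal.ofReal KE := by
    intro r hr
    refine HolderBridge.cknE_le_of_lintegral_le z hr.1 ?_
    have hr2τ : r ^ 2 ≤ τ := (pow_le_pow_left₀ hr.1.le hr.2 2).trans hτ₁
    have ha : 0 ≤ α * (τ - r ^ 2) := mul_nonneg hαpos.le (sub_nonneg.2 hr2τ)
    have hab : α * (τ - r ^ 2) ≤ α * τ := by nlinarith [sq_nonneg r]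
    have hb : α * τ ≤ T := by
      have h1 : α * τ ≤ α * (ν * T) := mul_le_mul_of_nonneg_left hτT hαpos.le
      rwa [← mul_assoc, hαν, one_mul] at h1
    -- the cylinder is the preimage of the physical cylinder `(α(τ - r²), ατ) × B(x, r)`
    have hpre : stAffine α 1 0 0 ⁻¹'
        (Ioo (α * (τ - r ^ 2)) (α * τ) ×ˢ ball x r) = parabolicCylinder r z := by
      ext w
      simp only [mem_preimage, mem_prod, stAffine_fst, stAffine_snd, mem_parabolicCylinder, mem_Ioo,
        mem_ball, zero_add, one_smul, hz]
      constructor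
      · rintro ⟨⟨h1, h2⟩, h3⟩
        exact ⟨⟨by nlinarith, lt_of_mul_lt_mul_left h2 hαpos.le⟩, h3⟩
      · rintro ⟨⟨h1, h2⟩, h3⟩
        exact ⟨⟨by nlinarith, mul_lt_mul_of_pos_left h2 hαpos⟩, h3⟩
    have hwin_cyl := HolderBridge.lintegral_cylinder_frobeniusNormSq_le_of_window hν hsol hLH ha hb
      (hwin _ _ ha hab hb) (ball x r)
    rw [← hpre, setLIntegral_frobeniusNormSq_stRescale hαpos one_pos 0 0 (α * 1)
      (fun t x => fderiv ℝ (u t) x) _]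
    refine (mul_le_mul' le_rfl hwin_cyl).trans (le_of_eq ?_)
    rw [show α * τ - α * (τ - r ^ 2) = α * r ^ 2 by ring, Real.sqrt_mul hαpos.le,
      Real.sqrt_sq hr.1.le, mul_one, one_pow, mul_one,
      ← ENNReal.ofReal_mul (sq_nonneg _), ← ENNReal.ofReal_mul (by positivity)]
    congr 1
    rw [hKE]
    field_simp
  -- (iv) Seregin's centre-uniform Morrey estimate at the centre `z`, radius `r₁`: all `R ≤ r₁/2`
  have hS : ∀ R ∈ Ioc (0 : ℝ) (r₁ / 2),
      cknAEss R z (α • stPull α 1 0 0 u) +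
        cknE R z ((α * 1) • stPull α 1 0 0 fun t x => fderiv ℝ (u t) x) +
        cknC R z (α • stPull α 1 0 0 u) + cknD R z (α ^ 2 • stPull α 1 0 0 q) ≤ KS := fun R hR =>
    hKS _ _ _ _ hsw hGv z r₁ hr₁pos hzsub
      (hA.trans (ENNReal.coe_toNNReal hA₀top).symm.le) (hD.trans (ENNReal.coe_toNNReal hD₀top).symm.le)
      (fun r hr => (hE r hr).trans (le_of_eq rfl)) R hR
  have hϱ2 : ϱ ∈ Ioc (0 : ℝ) (r₁ / 2) := ⟨hϱ.1, hϱ.2.le⟩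
  have hAϱ : cknAEss ϱ z (α • stPull α 1 0 0 u) ≤ KS :=
    le_trans (le_trans (le_trans le_self_add le_self_add) le_self_add) (hS ϱ hϱ2)
  have hDϱ : ∀ r' ∈ Ioc (0 : ℝ) ϱ, cknD r' z (α ^ 2 • stPull α 1 0 0 q) ≤ KS := fun r' hr' =>
    le_trans le_add_self (hS r' ⟨hr'.1, hr'.2.trans hϱ2.2⟩)
  have hϱr₁ : ϱ ≤ r₁ := by linarith [hϱ.2, hr₁pos]
  have hϱτ : ϱ ^ 2 ≤ τ := (pow_le_pow_left₀ hϱ.1.le hϱr₁ 2).trans hτ₁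
  have hzQ : parabolicCylinder ϱ z ⊆
      ((stPreimage α 1 0 0 Sl : TopologicalSpace.Opens (ℝ × EuclideanSpace ℝ (Fin 3))) :
        Set (ℝ × EuclideanSpace ℝ (Fin 3))) := hcyl _ _ x hϱτ hτT
  -- `E(ϱ) ≤ η` from the small physical dissipation
  have hEϱ : cknE ϱ z ((α * 1) • stPull α 1 0 0 fun t x => fderiv ℝ (u t) x) ≤ ENNReal.ofReal η := by
    refine HolderBridge.cknE_le_of_lintegral_le z hϱ.1 ?_
    rw [hz, hτ, ← hpre ϱ x, setLIntegral_frobeniusNormSq_stRescale hαpos one_pos 0 0 (α * 1)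
      (fun t x => fderiv ℝ (u t) x) _]
    simp only [finrank_euclideanSpace_fin, one_pow, mul_one]
    have e0 : α * (ν * T - ϱ ^ 2) = T - α * ϱ ^ 2 := by rw [mul_sub, hανT]
    rw [e0, hανT]
    calc ENNReal.ofReal (α ^ 2) * ENNReal.ofReal α⁻¹ *
          ∫⁻ w in Ioo (T - α * ϱ ^ 2) T ×ˢ ball x ϱ,
            ENNReal.ofReal (frobeniusNormSq (fderiv ℝ (u w.1) w.2))
        ≤ ENNReal.ofReal (α ^ 2) * ENNReal.ofReal α⁻¹ * ENNReal.ofReal (ν * η * ϱ) :=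
          mul_le_mul' le_rfl hdiss
      _ = ENNReal.ofReal (η * ϱ) := by
          rw [← ENNReal.ofReal_mul (sq_nonneg _), ← ENNReal.ofReal_mul (by positivity)]
          congr 1
          have e1 : α ^ 2 * α⁻¹ = α := by
            rw [pow_two, mul_assoc, mul_inv_cancel₀ hαpos.ne', mul_one]
          rw [e1]
          calc α * (ν * η * ϱ) = (α * ν) * (η * ϱ) := by ring
            _ = η * ϱ := by rw [hαν, one_mul]
  -- the quantum: `|v| ≤ 1/(ϑϱ)` a.e. on `Q_{ϑϱ/2}(z)`
  have hsmall := Hq _ _ _ _ hsw hGv z ϱ hϱ.1 hzQ hAϱ hDϱ hEϱ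
  -- un-zoom to the physical cylinder `U`
  set ρ' : ℝ := ϑ * ϱ / 2 with hρ'
  have hρ'pos : 0 < ρ' := by rw [hρ']; exact div_pos (mul_pos hϑ hϱ.1) two_pos
  set U : Set (ℝ × EuclideanSpace ℝ (Fin 3)) :=
    Ioo (α * (ν * T - ρ' ^ 2)) (α * (ν * T)) ×ˢ ball x ρ' with hU
  have hsmall' : ∀ᵐ w ∂(volume.restrict (stAffine α 1 0 0 ⁻¹' U)),
      ‖u (stAffine α 1 0 0 w).1 (stAffine α 1 0 0 w).2‖ ≤ ν * (1 / (ϑ * ϱ)) := by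
    rw [hU, hpre ρ' x, ← hτ, ← hz]
    filter_upwards [hsmall] with w hw
    rw [stAffine_fst, stAffine_snd]
    have ev : (α • stPull α 1 0 0 u) w.1 w.2 = α • u (0 + α * w.1) (0 + (1 : ℝ) • w.2) :=
      smul_stPull_apply α α 1 0 0 u _ _
    rw [ev, norm_smul, Real.norm_of_nonneg hαpos.le] at hw
    have h := mul_le_mul_of_nonneg_left hw hν.le
    rwa [← mul_assoc, hνα, one_mul] at h
  have hphys : ∀ᵐ w ∂(volume.restrict U), ‖u w.1 w.2‖ ≤ ν * (1 / (ϑ * ϱ)) :=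
    ae_restrict_of_ae_restrict_preimage_stAffine
      (P := fun w : ℝ × EuclideanSpace ℝ (Fin 3) => ‖u w.1 w.2‖ ≤ ν * (1 / (ϑ * ϱ)))
      hαpos one_pos 0 0 hsmall'
  -- every point of `U`, by continuity
  have hUopen : IsOpen U := isOpen_Ioo.prod isOpen_ball
  have hρ'ϱ : ρ' ≤ ϱ := by
    rw [hρ']
    have : ϑ * ϱ ≤ 1 * ϱ := mul_le_mul_of_nonneg_right hϑ1 hϱ.1.le
    linarith
  have hαr₁T : α * r₁ ^ 2 ≤ T := by
    have h1 : α * r₁ ^ 2 ≤ α * (ν * T / 2) := mul_le_mul_of_nonneg_left hr₁sq hαpos.le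
    have e : α * (ν * T / 2) = T / 2 := by rw [mul_div_assoc', hανT]
    linarith
  have hαρ' : α * ρ' ^ 2 ≤ T := by
    have h1 : ρ' ^ 2 ≤ r₁ ^ 2 := pow_le_pow_left₀ hρ'pos.le (hρ'ϱ.trans hϱr₁) 2
    have h2 : α * ρ' ^ 2 ≤ α * r₁ ^ 2 := mul_le_mul_of_nonneg_left h1 hαpos.le
    exact h2.trans hαr₁T
  have hUlow : 0 ≤ α * (ν * T - ρ' ^ 2) := by rw [mul_sub, hανT]; linarith
  have hUsub : U ⊆ Ico 0 T ×ˢ (univ : Set (EuclideanSpace ℝ (Fin 3))) := by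
    intro w hw
    rw [hU, mem_prod, mem_Ioo] at hw
    exact ⟨⟨hUlow.trans hw.1.1.le, by rw [← hανT]; exact hw.1.2⟩, mem_univ _⟩
  have hpt := CountQuarterLaw.norm_le_of_ae_of_continuousOn hUopen (hcont.mono hUsub) hphys
  -- the final cylinder `[T − r², T) × B_r(x)` with `r = ρ' min(1, √α)/2` lies in `U`
  set r : ℝ := ρ' * min 1 (Real.sqrt α) / 2 with hr
  have hm0 : 0 < min 1 (Real.sqrt α) := lt_min one_pos (Real.sqrt_pos.2 hαpos)
  have hm1 : min 1 (Real.sqrt α) ≤ 1 := min_le_left _ _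
  have hmα : min 1 (Real.sqrt α) ^ 2 ≤ α := by
    have h := pow_le_pow_left₀ hm0.le (min_le_right 1 (Real.sqrt α)) 2
    rwa [Real.sq_sqrt hαpos.le] at h
  have hrpos : 0 < r := by rw [hr]; positivity
  have hrρ' : r < ρ' := by
    rw [hr]
    have : ρ' * min 1 (Real.sqrt α) ≤ ρ' * 1 := mul_le_mul_of_nonneg_left hm1 hρ'pos.le
    linarith
  have hr2 : r ^ 2 < α * ρ' ^ 2 := by
    have e : r ^ 2 = ρ' ^ 2 * min 1 (Real.sqrt α) ^ 2 / 4 := by rw [hr]; ring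
    rw [e]
    have h1 : ρ' ^ 2 * min 1 (Real.sqrt α) ^ 2 ≤ ρ' ^ 2 * α :=
      mul_le_mul_of_nonneg_left hmα (sq_nonneg _)
    have h2 : 0 < α * ρ' ^ 2 := by positivity
    linarith
  refine ⟨r, hrpos, ν * (1 / (ϑ * ϱ)), fun t ht y hy => ?_⟩
  have hty : ((t, y) : ℝ × EuclideanSpace ℝ (Fin 3)) ∈ U := by
    rw [hU, mem_prod, mem_Ioo]
    refine ⟨⟨?_, by rw [hανT]; exact ht.2⟩, ball_subset_ball hrρ'.le hy⟩
    rw [mul_sub, hανT]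
    linarith [ht.1]
  exact hpt (t, y) hty

end Summit.NavierStokesRegularity.NavierStokesRegularity.Theorems.QuarterLawCountsScars

end
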